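import Summits.KontsevichZagierPeriods.KontsevichZagierPeriods.Theorems.FurushoPentagonReducedPeriodRingDefs
import Literature.NumberTheory.Transcendental.KZCubicalCalculus

/-!
# `ReducedPeriodRing` (stmt-KontsevichZagierPeriods-3929), line `effective-end-monoid`: stub `stub_cubeHalving_sound`

Crux `Summit.KontsevichZagierPeriods.KontsevichZagierPeriods.Theses.FurushoPentagon.ReducedPeriodRing`
(the formal period ring of the Kontsevich–Zagier calculus of moves has no nilpotents), line
`effective-end-monoid` (the cubical effective sub-calculus). This file proves the registered stub
`stub_cubeHalving_sound`: the DYADIC HALVING family `cubeHalvingRel` of cubical moves consists of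
relations of the Kontsevich–Zagier calculus (`KZ.relations`).

Given tame cube representations `r, r₁, r₂` in dimension `n` and a coordinate `i` with
`r₁.integrand x = ½ · r.integrand (x with xᵢ ↦ xᵢ/2)` and
`r₂.integrand x = ½ · r.integrand (x with xᵢ ↦ (1 + xᵢ)/2)` on `[0,1]ⁿ`, the element
`[r] − [r₁] − [r₂]` is the sum of ONE domain-additivity move (Kontsevich–Zagier rule (1)) for
`[0,1]ⁿ = {xᵢ ≤ ½} ∪ {½ ≤ xᵢ}` (overlap inside the Lebesgue-null hyperplane `xᵢ = ½`) and TWO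
change-of-variables moves (rule (2)) along the affine rescalings of the cube onto the two halves
(Jacobian `½`). This decomposition is carried out, move by move, in the tree file
`Literature/NumberTheory/Transcendental/KZCubicalCalculus.lean`
(`KZ.cubicalSubdivGens_subset_relations`, with `KZ.lowerHalfCube`, `KZ.upperHalfCube`,
`KZ.lowerHalfMap`, `KZ.upperHalfMap`, `KZ.halfScaleCLM`, `KZ.det_halfScaleCLM`); the family
`KZ.cubicalSubdivGens` there is, definitionally, the family `cubeHalvingRel` of this line
(`KZ.cube n` and `unitCube n` are both the literal `{x | ∀ i, 0 ≤ x i ∧ x i ≤ 1}`), so the stub is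
that theorem.

## References

* M. Kontsevich, D. Zagier, *Periods*, in: Mathematics Unlimited — 2001 and Beyond (2001), §1.2,
  rules (1), (2).
* J. Ayoub, *Periods and the conjectures of Grothendieck and Kontsevich–Zagier*, EMS Newsl. 91
  (2014), Def. 10, Prop. 11.
-/

noncomputable section

namespace Summit.KontsevichZagierPeriods.FurushoPentagon.ReducedPeriodRing

open Set
open Literature.NumberTheory.Transcendental Literature.NumberTheory.Transcendental.KZ

/-- The dyadic halving family of this line is, definitionally, the subdivision family
`KZ.cubicalSubdivGens` of `KZCubicalCalculus.lean` (`unitCube n` and `KZ.cube n` are the same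
literal set-builder). [folklore] -/
private theorem cubeHalvingRel_eq_cubicalSubdivGens : cubeHalvingRel = KZ.cubicalSubdivGens := rfl

/-- **Dyadic halving is a KZ relation** (stub `stub_cubeHalving_sound` of line
`effective-end-monoid`): for tame cube representations `r, r₁, r₂` in dimension `n` and a
coordinate `i` with `r₁.integrand x = ½ · r.integrand (x with xᵢ ↦ xᵢ/2)` and
`r₂.integrand x = ½ · r.integrand (x with xᵢ ↦ (1 + xᵢ)/2)` on `[0,1]ⁿ`, the element
`[r] − [r₁] − [r₂]` lies in `KZ.relations`: it is the sum of the domain-additivity move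
`[r] − [r|_{xᵢ ≤ ½}] − [r|_{½ ≤ xᵢ}]` (the overlap lies in the null hyperplane `xᵢ = ½`) and the
two change-of-variables moves `[r₁] − [r|_{xᵢ ≤ ½}]`, `[r₂] − [r|_{½ ≤ xᵢ}]` along the affine
rescalings `x ↦ (x with xᵢ ↦ xᵢ/2)`, `x ↦ (x with xᵢ ↦ (1 + xᵢ)/2)` of Jacobian `½`
(`KZ.cubicalSubdivGens_subset_relations`). [Kontsevich–Zagier 2001, §1.2 rules (1), (2)] -/
theorem stub_cubeHalving_sound : cubeHalvingRel ⊆ (relations : Set FormalRep) := by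
  rw [cubeHalvingRel_eq_cubicalSubdivGens]
  exact KZ.cubicalSubdivGens_subset_relations

end Summit.KontsevichZagierPeriods.FurushoPentagon.ReducedPeriodRing
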